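import Literature.NumberTheory.NumberFields.UnramifiedDiscriminant
import Mathlib.NumberTheory.NumberField.Discriminant.Basic
import Mathlib.NumberTheory.NumberField.Cyclotomic.Basic
import HarnessLib

/-!
# Crux `GoodLatticeBDPValue` (stmt-BirchSwinnertonDyer-19032), line `halves`, AN-3 Stub B road — brick F4a:
# MINKOWSKI: a number field of discriminant `±3` (e.g. `ℚ(ζ₃)`) has NO everywhere-unramified extension

Width seat bsd-line-x1-p1-w3 (gen 4). HONEST FRAMING (cell `bsd-eis`, run/shared/lean/pub/bsd-eis/):
TOOL THEOREMS ONLY (no `def`, no named fact, no `sorry`); classical algebraic number theory; nothing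
about a summit statement, Keller–Yin Thm. 2.2.2 or crux 2 is proved here; 0 stubs / cells / labels move.

WHY (road memo `HOME/line-x1-p1-w3-g4/AN3-StubB-elementary-road.md`, evidence #44, global input
(G-K)). The splitting lemma (brick F5, `FullDescentSplitting.exists_stable_complement_mod`,
p653931) consumes ONE arithmetic fact: a homomorphism `G_{ℚ(ζ₃)} → ℤ/3` (with open kernel) killing
every inertia group is trivial, i.e. `K = ℚ(ζ₃)` has no unramified cyclic cubic extension. The memo
first cited class field theory (`h(K) = 1`); in fact MINKOWSKI'S BOUND suffices and gives more: `K`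
has no non-trivial extension unramified at all finite primes AT ALL. This file is the number-field
half of that statement (the Galois-group half — inertia images ↔ `IsUnramifiedAt` — is the tree's
`isUnramifiedIn_of_forall_inertia_absRestrictNormalHom_eq_one` /
`NumberFields.InertiaGeneratesGalois`, to be applied by the assembly):

* `finrank_eq_one_of_forall_isUnramifiedAt_of_natAbs_discr_eq_three` — `K ⊆ L` number fields,
  `|d_K| = 3`, `[K : ℚ] = 2`, every maximal ideal of `𝓞 L` unramified over `𝓞 K` ⟹ `[L : K] = 1`.
  Proof: `|d_L| = |d_K|^{[L:K]} = 3^m` (tree `natAbs_discr_eq_pow_of_forall_isUnramifiedAt`,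
  Neukirch III (2.6)/(2.9)/(2.10)) against Minkowski `|d_L| ≥ (4/9)(3π/4)^{2m}` (Mathlib
  `NumberField.abs_discr_ge`), impossible for `m ≥ 2` since `π > 3`.
* `finrank_eq_one_of_forall_isUnramifiedAt_cyclotomic_three` — the same for any `K` with
  `IsCyclotomicExtension {3} ℚ K` (`d_K = −3`, Mathlib `IsCyclotomicExtension.Rat.discr_prime`).
* `finrank_eq_one_of_forall_isUnramifiedAt_of_natAbs_discr_eq_one` — the same over any `K` with
  `|d_K| = 1` (i.e. `K = ℚ`): Hermite–Minkowski `NumberField.abs_discr_gt_two`.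

References: [NeukirchANT1999] Ch. III (2.6), (2.9), (2.10), (2.17) (Minkowski's bound);
[Washington1997] Prop. 2.1 / Lemma 2 .2 (`d(ℚ(ζ_p)) = ±p^{p−2}`).
-/

noncomputable section

open NumberField Module

set_option autoImplicit false
set_option linter.dupNamespace false

namespace Summit.BirchSwinnertonDyer.BirchSwinnertonDyer.Theorems.FullDescentMinkowski

open Literature.NumberTheory.NumberFields

/-- The numerical heart: `3^m < (4/9)·(3π/4)^{2m}` for `m ≥ 2` (uses only `π > 3`). [folklore] -/
theorem three_pow_lt_minkowski {m : ℕ} (hm : 2 ≤ m) :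
    (3 : ℝ) ^ m < (4 / 9 : ℝ) * (3 * Real.pi / 4) ^ (2 * m) := by
  have hπ : (3 : ℝ) < Real.pi := Real.pi_gt_three
  -- `(3π/4)^2 ≥ 81/16`, so `(3π/4)^{2m} ≥ (81/16)^m = (27/16)^m · 3^m`
  have h1 : (81 / 16 : ℝ) ≤ (3 * Real.pi / 4) ^ 2 := by nlinarith
  have h2 : ((81 / 16 : ℝ)) ^ m ≤ (3 * Real.pi / 4) ^ (2 * m) := by
    rw [pow_mul]
    exact pow_le_pow_left₀ (by norm_num) h1 m
  have h3 : ((27 / 16 : ℝ)) ^ 2 ≤ (27 / 16 : ℝ) ^ m := pow_le_pow_right₀ (by norm_num) hm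
  have h4 : (81 / 16 : ℝ) ^ m = (27 / 16 : ℝ) ^ m * 3 ^ m := by
    rw [← mul_pow]; norm_num
  have h5 : (0 : ℝ) < 3 ^ m := by positivity
  calc (3 : ℝ) ^ m < (4 / 9 : ℝ) * ((27 / 16 : ℝ) ^ 2 * 3 ^ m) := by nlinarith
    _ ≤ (4 / 9 : ℝ) * ((27 / 16 : ℝ) ^ m * 3 ^ m) := by gcongr
    _ = (4 / 9 : ℝ) * (81 / 16 : ℝ) ^ m := by rw [h4]
    _ ≤ (4 / 9 : ℝ) * (3 * Real.pi / 4) ^ (2 * m) := by gcongr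

/-- **No everywhere-unramified extension of a quadratic field of discriminant `±3`.** Let `K ⊆ L` be
number fields with `|d_K| = 3`, `[K : ℚ] = 2`, and suppose every maximal ideal of `𝓞 L` is
unramified over `𝓞 K`. Then `[L : K] = 1`. (`|d_L| = 3^{[L:K]}` by Neukirch III (2.9)–(2.10) versus
Minkowski's bound.) [cite: NeukirchANT1999, Ch. III Thm. (2.9), Cor. (2.10), Thm. (2.17)] -/
theorem finrank_eq_one_of_forall_isUnramifiedAt_of_natAbs_discr_eq_three
    {K L : Type*} [Field K] [NumberField K] [Field L] [NumberField L] [Algebra K L]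
    (hK : (discr K).natAbs = 3) (hK2 : finrank ℚ K = 2)
    (h : ∀ (P : Ideal (𝓞 L)) [P.IsMaximal], Algebra.IsUnramifiedAt (𝓞 K) P) :
    finrank K L = 1 := by
  haveI : Algebra.IsAlgebraic ℚ L := Algebra.IsAlgebraic.of_finite ℚ L
  haveI : Module.Finite K L := Module.Finite.of_restrictScalars_finite ℚ K L
  set m := finrank K L with hm
  have hm0 : 0 < m := finrank_pos
  have hdL : (discr L).natAbs = 3 ^ m := by
    rw [natAbs_discr_eq_pow_of_forall_isUnramifiedAt h, hK]
  have hnL : finrank ℚ L = 2 * m := by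
    rw [← Module.finrank_mul_finrank ℚ K L, hK2]
  by_contra hne
  have hm2 : 2 ≤ m := by omega
  have hmink := NumberField.abs_discr_ge (K := L) (by rw [hnL]; omega)
  rw [hnL] at hmink
  have habs : ((|discr L| : ℤ) : ℝ) = (3 : ℝ) ^ m := by
    rw [Int.abs_eq_natAbs, hdL]
    push_cast
    rfl
  rw [habs] at hmink
  exact absurd hmink (not_le.mpr (three_pow_lt_minkowski hm2))

/-- **`ℚ(ζ₃)` has no everywhere-unramified extension**: for `K` with `IsCyclotomicExtension {3} ℚ K`
(`d_K = −3` by Mathlib's `IsCyclotomicExtension.Rat.discr_prime`, `[K : ℚ] = φ(3) = 2`) and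
`K ⊆ L` with every maximal ideal of `𝓞 L` unramified over `𝓞 K`: `[L : K] = 1`.
[cite: NeukirchANT1999, Ch. III Thm. (2.17)] [cite: Washington1997, Prop. 2.1, Thm. 2.6] -/
theorem finrank_eq_one_of_forall_isUnramifiedAt_cyclotomic_three
    {K L : Type*} [Field K] [NumberField K] [IsCyclotomicExtension {3} ℚ K]
    [Field L] [NumberField L] [Algebra K L]
    (h : ∀ (P : Ideal (𝓞 L)) [P.IsMaximal], Algebra.IsUnramifiedAt (𝓞 K) P) :
    finrank K L = 1 := by
  haveI : Fact (Nat.Prime 3) := ⟨Nat.prime_three⟩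
  have hd : discr K = -3 := by
    have h3 := IsCyclotomicExtension.Rat.discr_prime 3 K
    norm_num at h3
    exact h3
  have hK : (discr K).natAbs = 3 := by rw [hd]; rfl
  have hK2 : finrank ℚ K = 2 := by
    rw [IsCyclotomicExtension.finrank (n := 3) K (Polynomial.cyclotomic.irreducible_rat (by norm_num))]
    rfl
  exact finrank_eq_one_of_forall_isUnramifiedAt_of_natAbs_discr_eq_three hK hK2 h

/-- **`ℚ` has no everywhere-unramified extension** (Hermite–Minkowski, Mathlib
`NumberField.abs_discr_gt_two`): for `K` with `|d_K| = 1` and `K ⊆ L` with every maximal ideal of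
`𝓞 L` unramified over `𝓞 K`, `[L : K] = 1`. [cite: NeukirchANT1999, Ch. III Thm. (2.17), (2.18)] -/
theorem finrank_eq_one_of_forall_isUnramifiedAt_of_natAbs_discr_eq_one
    {K L : Type*} [Field K] [NumberField K] [Field L] [NumberField L] [Algebra K L]
    (hK : (discr K).natAbs = 1)
    (h : ∀ (P : Ideal (𝓞 L)) [P.IsMaximal], Algebra.IsUnramifiedAt (𝓞 K) P) :
    finrank K L = 1 := by
  haveI : Algebra.IsAlgebraic ℚ L := Algebra.IsAlgebraic.of_finite ℚ L
  haveI : Module.Finite K L := Module.Finite.of_restrictScalars_finite ℚ K L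
  have hdL : (discr L).natAbs = 1 := by
    rw [natAbs_discr_eq_pow_of_forall_isUnramifiedAt h, hK, one_pow]
  have hnL : finrank ℚ L = 1 := by
    by_contra hne
    have h1 : 1 < finrank ℚ L := by
      have := finrank_pos (R := ℚ) (M := L)
      omega
    have h2 := NumberField.abs_discr_gt_two h1
    have : |discr L| = ((discr L).natAbs : ℤ) := (Int.natCast_natAbs _).symm
    rw [this, hdL] at h2
    norm_num at h2
  have hmul := Module.finrank_mul_finrank ℚ K L
  rw [hnL] at hmul
  exact (Nat.eq_one_of_mul_eq_one_left hmul.symm.symm)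

end Summit.BirchSwinnertonDyer.BirchSwinnertonDyer.Theorems.FullDescentMinkowski
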